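import Mathlib
import Literature.AlgebraicGeometry.Resolution.FormalAxisOfNearChain
import HarnessLib

/-!
# The formal axis of an infinite chain of near points — with its generators exposed

Topic: `Literature/AlgebraicGeometry/Resolution`.  Companion of `FormalAxisOfNearChain.lean` (same statement and proof,
Cossart–Piltant 2008, proof of Prop. 4.4, p. 11: "there exists a regular (possibly formal) curve `Γ` such that
`x_{σ(i)}` belongs to the strict transform of `Γ` for `i ≥ i₁` […] `Γ ⊆ Σ(i₁)`"): for a regular local ring `(R, 𝔪)` of
dimension `3` with regular system of parameters `(u, y₂, y₃)` and corrected parameters `z₂⁽ᴺ⁾, z₃⁽ᴺ⁾ → ŷ₂, ŷ₃`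
(`z⁽⁰⁾ = y`, `z⁽ᴺ⁺¹⁾ − z⁽ᴺ⁾ ∈ 𝔪^{N+2}`) with `J ⊆ (z₂⁽ᴺ⁾, z₃⁽ᴺ⁾)^μ + (u^{N+1})` for all `N`, the formal axis
`𝔓 = (ŷ₂, ŷ₃) ⊂ (AdicCompletion (maximalIdeal R) R)` is a prime `≠ 𝔪̂` with `J (AdicCompletion (maximalIdeal R) R) ⊆ 𝔓^μ`.  The tree theorem
`exists_prime_ne_maximalIdeal_map_le_pow` hides the generators behind the existential; consumers that must relate `𝔓`
to the limits `ŷᵢ = adicLimit zᵢ` (e.g. to read `ŷ₂ ∈ 𝔓` as «the formal curve lies in the formal hypersurface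
`ŷ₂ = 0`», the leaf step of the clean births analysis of `Summits/…/CleanModels`) need them EXPOSED:

* `exists_prime_ne_maximalIdeal_map_le_pow_mem` — the same conclusion PLUS `ŷ₂ ∈ 𝔓`, `ŷ₃ ∈ 𝔓`, `u ∉ 𝔓` and
  `(u, ŷ₂, ŷ₃) = 𝔪̂` (proof verbatim from `FormalAxisOfNearChain.lean`, res-inputs cell, with the last lines added; the
  convergence proofs `hzᵢ'` feeding `adicLimit` are taken as arguments so that the statement names the limits).

## Sources

* V. Cossart, O. Piltant, J. Algebra 320 (2008), proof of Prop. 4.4, p. 11. [CossartPiltant2008]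
* H. Matsumura, *Commutative Ring Theory* (1986), §8, Thm. 8.10. [Matsumura1987]

AI-written formalization, weaker than expert review.  No summit statement is proved here.
-/

noncomputable section

open IsLocalRing

namespace Literature.AlgebraicGeometry.Resolution

universe u

section Axis

variable {R : Type u} [CommRing R] [IsRegularLocalRing R]

/-- **The formal axis of an infinite chain of near points, generators exposed** (Cossart–Piltant's formal curve `Γ`
with `Γ ⊆ Σ`): for corrected parameters `z⁽ᴺ⁾ → ŷ` with `J ⊆ (z₂⁽ᴺ⁾, z₃⁽ᴺ⁾)^μ + (u^{N+1})` for all `N`, there is a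
prime `𝔓 ≠ 𝔪̂` of `(AdicCompletion (maximalIdeal R) R)` with `J (AdicCompletion (maximalIdeal R) R) ⊆ 𝔓^μ`, containing `ŷ₂ = adicLimit z₂` and `ŷ₃ = adicLimit z₃`, not containing `u`,
and `(u, ŷ₂, ŷ₃) = 𝔪̂` (so `𝔓 = (ŷ₂, ŷ₃)` and `(AdicCompletion (maximalIdeal R) R)/𝔓` is a discrete valuation ring with uniformizer `u`).
[cite: CossartPiltant2008, proof of Prop. 4.4, p. 11] -/
theorem exists_prime_ne_maximalIdeal_map_le_pow_mem (u y₂ y₃ : R)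
    (hgen : Ideal.span {u, y₂, y₃} = maximalIdeal R) (hdim : ringKrullDim R = 3)
    (z₂ z₃ : ℕ → R) (hz₂ : ∀ n, z₂ (n + 1) - z₂ n ∈ maximalIdeal R ^ (n + 2))
    (hz₃ : ∀ n, z₃ (n + 1) - z₃ n ∈ maximalIdeal R ^ (n + 2))
    (hz₂' : ∀ n, z₂ (n + 1) - z₂ n ∈ maximalIdeal R ^ n) (hz₃' : ∀ n, z₃ (n + 1) - z₃ n ∈ maximalIdeal R ^ n)
    (h0₂ : z₂ 0 = y₂) (h0₃ : z₃ 0 = y₃)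
    (J : Ideal R) (μ : ℕ)
    (hJ : ∀ N, J ≤ Ideal.span {z₂ N, z₃ N} ^ μ ⊔ Ideal.span {u ^ (N + 1)}) :
    ∃ 𝔓 : Ideal (AdicCompletion (maximalIdeal R) R), 𝔓.IsPrime ∧ 𝔓 ≠ maximalIdeal (AdicCompletion (maximalIdeal R) R) ∧ J.map (algebraMap R (AdicCompletion (maximalIdeal R) R)) ≤ 𝔓 ^ μ ∧
      adicLimit z₂ hz₂' ∈ 𝔓 ∧ adicLimit z₃ hz₃' ∈ 𝔓 ∧ algebraMap R (AdicCompletion (maximalIdeal R) R) u ∉ 𝔓 ∧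
      Ideal.span {algebraMap R (AdicCompletion (maximalIdeal R) R) u, adicLimit z₂ hz₂', adicLimit z₃ hz₃'} = maximalIdeal (AdicCompletion (maximalIdeal R) R) := by
  classical
  set ŷ₂ : (AdicCompletion (maximalIdeal R) R) := adicLimit z₂ hz₂' with hŷ₂
  set ŷ₃ : (AdicCompletion (maximalIdeal R) R) := adicLimit z₃ hz₃' with hŷ₃
  set ι := algebraMap R (AdicCompletion (maximalIdeal R) R) with hι
  set 𝔓 : Ideal (AdicCompletion (maximalIdeal R) R) := Ideal.span {ŷ₂, ŷ₃} with h𝔓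
  haveI : IsRegularLocalRing (AdicCompletion (maximalIdeal R) R) := isRegularLocalRing_adicCompletion R
  have hdim' : ringKrullDim (AdicCompletion (maximalIdeal R) R) = 3 := by rw [ringKrullDim_adicCompletion, hdim]
  have hmmap : maximalIdeal (AdicCompletion (maximalIdeal R) R) = (maximalIdeal R).map ι := AdicCompletion.maximalIdeal_eq_map
  -- (a) `J (AdicCompletion (maximalIdeal R) R) ⊆ 𝔓^μ + 𝔪̂ⁿ` for all `n`, hence `J (AdicCompletion (maximalIdeal R) R) ⊆ 𝔓^μ`
  have hJle : J.map ι ≤ 𝔓 ^ μ := by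
    refine le_of_forall_le_sup_pow fun n => ?_
    have hzmem : ∀ (z : ℕ → R) (hz : ∀ n, z (n + 1) - z n ∈ maximalIdeal R ^ n) (ŷ : (AdicCompletion (maximalIdeal R) R)),
        ŷ = adicLimit z hz → ŷ ∈ 𝔓 → ι (z n) ∈ 𝔓 ⊔ maximalIdeal (AdicCompletion (maximalIdeal R) R) ^ n := by
      intro z hz ŷ hŷ hŷP
      have hsub := adicLimit_sub_of_mem_pow z hz n
      rw [← hŷ] at hsub
      have : ι (z n) = ŷ - (ŷ - ι (z n)) := by ring
      rw [this]
      exact Ideal.sub_mem _ (Ideal.mem_sup_left hŷP) (Ideal.mem_sup_right hsub)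
    have h2 : ι (z₂ n) ∈ 𝔓 ⊔ maximalIdeal (AdicCompletion (maximalIdeal R) R) ^ n :=
      hzmem z₂ hz₂' ŷ₂ hŷ₂ (Ideal.subset_span (by simp))
    have h3 : ι (z₃ n) ∈ 𝔓 ⊔ maximalIdeal (AdicCompletion (maximalIdeal R) R) ^ n :=
      hzmem z₃ hz₃' ŷ₃ hŷ₃ (Ideal.subset_span (by simp))
    have hspan : (Ideal.span {z₂ n, z₃ n}).map ι ≤ 𝔓 ⊔ maximalIdeal (AdicCompletion (maximalIdeal R) R) ^ n := by
      rw [Ideal.map_span, Ideal.span_le]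
      rintro _ ⟨a, ha, rfl⟩
      simp only [Set.mem_insert_iff, Set.mem_singleton_iff] at ha
      rcases ha with rfl | rfl
      · exact h2
      · exact h3
    have hu : ι (u ^ (n + 1)) ∈ maximalIdeal (AdicCompletion (maximalIdeal R) R) ^ n := by
      rw [map_pow]
      refine Ideal.pow_le_pow_right (Nat.le_succ n) (Ideal.pow_mem_pow ?_ (n + 1))
      rw [hmmap]
      exact Ideal.mem_map_of_mem _ (hgen ▸ Ideal.subset_span (by simp))
    calc J.map ι ≤ (Ideal.span {z₂ n, z₃ n} ^ μ ⊔ Ideal.span {u ^ (n + 1)}).map ι :=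
          Ideal.map_mono (hJ n)
      _ = (Ideal.span {z₂ n, z₃ n}).map ι ^ μ ⊔ (Ideal.span {u ^ (n + 1)}).map ι := by
          rw [Ideal.map_sup, Ideal.map_pow]
      _ ≤ (𝔓 ⊔ maximalIdeal (AdicCompletion (maximalIdeal R) R) ^ n) ^ μ ⊔ maximalIdeal (AdicCompletion (maximalIdeal R) R) ^ n := by
          refine sup_le_sup (Ideal.pow_right_mono hspan μ) ?_
          rw [Ideal.map_span, Set.image_singleton, Ideal.span_le, Set.singleton_subset_iff]
          exact hu
      _ ≤ 𝔓 ^ μ ⊔ maximalIdeal (AdicCompletion (maximalIdeal R) R) ^ n :=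
          sup_le (sup_pow_le_pow_sup _ _ μ) le_sup_right
  -- (b) `(u, ŷ₂, ŷ₃)` is a regular system of parameters of `(AdicCompletion (maximalIdeal R) R)`
  have hy₂m : y₂ ∈ maximalIdeal R := hgen ▸ Ideal.subset_span (by simp)
  have hy₃m : y₃ ∈ maximalIdeal R := hgen ▸ Ideal.subset_span (by simp)
  have hum : u ∈ maximalIdeal R := hgen ▸ Ideal.subset_span (by simp)
  -- `z⁽¹⁾ ∈ 𝔪`, `z⁽²⁾ − y ∈ 𝔪²`
  have hz1 : ∀ (z : ℕ → R), (∀ n, z (n + 1) - z n ∈ maximalIdeal R ^ (n + 2)) → ∀ y ∈ maximalIdeal R,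
      z 0 = y → z 1 ∈ maximalIdeal R ∧ z 2 - y ∈ maximalIdeal R ^ 2 := by
    intro z hz y hy h0
    have h01 : z 1 - z 0 ∈ maximalIdeal R ^ 2 := hz 0
    have h12 : z 2 - z 1 ∈ maximalIdeal R ^ 3 := hz 1
    constructor
    · have : z 1 = (z 1 - z 0) + y := by rw [h0]; ring
      rw [this]
      exact Ideal.add_mem _ (Ideal.pow_le_self (by norm_num) h01) hy
    · have : z 2 - y = (z 2 - z 1) + (z 1 - z 0) := by rw [h0]; ring
      rw [this]
      exact Ideal.add_mem _ (Ideal.pow_le_pow_right (by norm_num) h12) h01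
  obtain ⟨hz₂1, hz₂2⟩ := hz1 z₂ hz₂ y₂ hy₂m h0₂
  obtain ⟨hz₃1, hz₃2⟩ := hz1 z₃ hz₃ y₃ hy₃m h0₃
  have hŷmem : ∀ (z : ℕ → R) (hz : ∀ n, z (n + 1) - z n ∈ maximalIdeal R ^ n),
      z 1 ∈ maximalIdeal R → adicLimit z hz ∈ maximalIdeal (AdicCompletion (maximalIdeal R) R) := by
    intro z hz h1
    have hsub := adicLimit_sub_of_mem_pow z hz 1
    rw [pow_one] at hsub
    have : adicLimit z hz = (adicLimit z hz - ι (z 1)) + ι (z 1) := by ring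
    rw [this]
    refine Ideal.add_mem _ hsub ?_
    rw [hmmap]; exact Ideal.mem_map_of_mem _ h1
  have hιy : ∀ (z : ℕ → R) (hz : ∀ n, z (n + 1) - z n ∈ maximalIdeal R ^ n) (y : R),
      z 2 - y ∈ maximalIdeal R ^ 2 →
      ι y ∈ Ideal.span {adicLimit z hz} ⊔ maximalIdeal (AdicCompletion (maximalIdeal R) R) ^ 2 := by
    intro z hz y h2
    have hsub := adicLimit_sub_of_mem_pow z hz 2
    have : ι y = adicLimit z hz - (adicLimit z hz - ι (z 2)) - ι (z 2 - y) := by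
      rw [map_sub]; ring
    rw [this]
    refine Ideal.sub_mem _ (Ideal.sub_mem _ (Ideal.mem_sup_left (Ideal.subset_span rfl))
      (Ideal.mem_sup_right hsub)) (Ideal.mem_sup_right ?_)
    rw [hmmap, ← Ideal.map_pow]
    exact Ideal.mem_map_of_mem _ h2
  set x : Fin 3 → (AdicCompletion (maximalIdeal R) R) := ![ι u, ŷ₂, ŷ₃] with hx
  have hxspan : Ideal.span (Set.range x) = maximalIdeal (AdicCompletion (maximalIdeal R) R) := by
    have hrange : Set.range x = {ι u, ŷ₂, ŷ₃} := by
      rw [hx]; ext a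
      simp [Matrix.range_cons, Matrix.range_empty]
      tauto
    rw [hrange]
    apply le_antisymm
    · rw [Ideal.span_le]
      intro a ha
      simp only [Set.mem_insert_iff, Set.mem_singleton_iff] at ha
      rcases ha with rfl | rfl | rfl
      · rw [hmmap]; exact Ideal.mem_map_of_mem _ hum
      · exact hŷmem z₂ hz₂' hz₂1
      · exact hŷmem z₃ hz₃' hz₃1
    · -- Nakayama: `𝔪̂ ≤ (u, ŷ₂, ŷ₃) + 𝔪̂²`
      refine Submodule.le_of_le_smul_of_le_jacobson_bot (maximalIdeal (AdicCompletion (maximalIdeal R) R)).fg_of_isNoetherianRing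
        (IsLocalRing.maximalIdeal_le_jacobson _) ?_
      rw [Ideal.smul_eq_mul, ← sq]
      have hmspan : Ideal.span (ι '' {u, y₂, y₃}) = (maximalIdeal R).map ι := by
        rw [← Ideal.map_span, hgen]
      conv_lhs => rw [hmmap, ← hmspan]
      rw [Ideal.span_le]
      rintro _ ⟨a, ha, rfl⟩
      simp only [Set.mem_insert_iff, Set.mem_singleton_iff] at ha
      have hle₂ : Ideal.span {ŷ₂} ⊔ maximalIdeal (AdicCompletion (maximalIdeal R) R) ^ 2 ≤
          Ideal.span {ι u, ŷ₂, ŷ₃} ⊔ maximalIdeal (AdicCompletion (maximalIdeal R) R) ^ 2 :=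
        sup_le_sup_right (Ideal.span_mono (Set.singleton_subset_iff.mpr (by simp))) _
      have hle₃ : Ideal.span {ŷ₃} ⊔ maximalIdeal (AdicCompletion (maximalIdeal R) R) ^ 2 ≤
          Ideal.span {ι u, ŷ₂, ŷ₃} ⊔ maximalIdeal (AdicCompletion (maximalIdeal R) R) ^ 2 :=
        sup_le_sup_right (Ideal.span_mono (Set.singleton_subset_iff.mpr (by simp))) _
      rcases ha with rfl | rfl | rfl
      · exact Ideal.mem_sup_left (Ideal.subset_span (by simp))
      · exact hle₂ (hιy z₂ hz₂' _ hz₂2)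
      · exact hle₃ (hιy z₃ hz₃' _ hz₃2)
  have hfr : (maximalIdeal (AdicCompletion (maximalIdeal R) R)).spanFinrank = 3 := by
    have := (isRegularLocalRing_iff (AdicCompletion (maximalIdeal R) R)).mp inferInstance
    rw [hdim'] at this
    exact_mod_cast this
  -- `𝔓 = (x₁, x₂)` is prime
  have h𝔓eq : 𝔓 = Ideal.span (x '' ↑({1, 2} : Finset (Fin 3))) := by
    rw [h𝔓]; congr 1
    ext a
    simp [hx]
    tauto
  have hprime : 𝔓.IsPrime := by
    rw [h𝔓eq]; exact isPrime_span_image hfr x hxspan {1, 2}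
  -- `𝔓 ≠ 𝔪̂`: `𝔪̂` needs three generators
  have hne : 𝔓 ≠ maximalIdeal (AdicCompletion (maximalIdeal R) R) := by
    intro heq
    have h1 := Submodule.spanFinrank_span_le_ncard_of_finite (R := (AdicCompletion (maximalIdeal R) R))
      (Set.toFinite ({ŷ₂, ŷ₃} : Set (AdicCompletion (maximalIdeal R) R)))
    have h2 : ({ŷ₂, ŷ₃} : Set (AdicCompletion (maximalIdeal R) R)).ncard ≤ 2 := by
      rw [← Finset.coe_pair, Set.ncard_coe_finset]; exact Finset.card_le_two
    have h3 : (Ideal.span {ŷ₂, ŷ₃} : Ideal (AdicCompletion (maximalIdeal R) R)).spanFinrank = 3 := by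
      change 𝔓.spanFinrank = 3
      rw [heq]; exact hfr
    change (Ideal.span {ŷ₂, ŷ₃}).spanFinrank ≤ _ at h1
    omega
  -- the generators: `ŷ₂, ŷ₃ ∈ 𝔓`, `u ∉ 𝔓` (else `𝔓 = (u, ŷ₂, ŷ₃) = 𝔪̂`), `(u, ŷ₂, ŷ₃) = 𝔪̂`
  have hmem₂ : ŷ₂ ∈ 𝔓 := Ideal.subset_span (by simp)
  have hmem₃ : ŷ₃ ∈ 𝔓 := Ideal.subset_span (by simp)
  have hxspan' : Ideal.span {ι u, ŷ₂, ŷ₃} = maximalIdeal (AdicCompletion (maximalIdeal R) R) := by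
    have hrange : Set.range x = {ι u, ŷ₂, ŷ₃} := by
      rw [hx]; ext a
      simp [Matrix.range_cons, Matrix.range_empty]
      tauto
    rw [← hrange]; exact hxspan
  have hu : ι u ∉ 𝔓 := by
    intro huP
    apply hne
    apply le_antisymm (le_maximalIdeal hprime.ne_top)
    rw [← hxspan', Ideal.span_le]
    intro a ha
    simp only [Set.mem_insert_iff, Set.mem_singleton_iff] at ha
    rcases ha with rfl | rfl | rfl
    · exact huP
    · exact hmem₂
    · exact hmem₃
  exact ⟨𝔓, hprime, hne, hJle, hmem₂, hmem₃, hu, hxspan'⟩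


end Axis

end Literature.AlgebraicGeometry.Resolution

end
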